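import Summits.HodgeConjecture.HodgeConjecture.Theorems.BoundaryReadoutBoundarySupplyConstantFamily
import Literature.AlgebraicGeometry.HodgeTheory.IsoTransport
import HarnessLib

/-!
# Route BoundaryReadout — crux `BoundarySupply` (stmt-HodgeConjecture-15912): the anchor statements
# of line `qbar-fibre` on the constant family

Companion of `BoundaryReadoutBoundarySupplyConstantFamily` (helper file for the crux item
stmt-HodgeConjecture-15912; it closes nothing). The registered line `qbar-fibre` of the crux
(`Cruxes/BoundarySupply/Lines/qbar_fibre.lean`) cuts `BoundarySupply` into `AnchorSupply` (the
crux's family block with "`ξ|_{Y_i}` absolute" replaced by "`Y_i` arithmetic ∨ `ξ|_{Y_i}` a cycle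
class"), `AbsoluteOverNumberFields` and `CycleClassesAbsolute`. With the constant family
`X × ℙ¹ ⟶ ℙ¹` (`constFamily_block`, `constFamily_anchor`) this file proves, sorry-free:

* `anchorSupply_block_of_definable` / `anchorSupply_block_of_mem_algebraicClasses` — the
  `∃`-block of `AnchorSupply` holds for every rational `(p,p)`-class on an ARITHMETIC `X`, and for
  every CYCLE class on any smooth projective `X`;
* `anchorSupply_of_hodgeConjecture` — hence the registered hardest stub `AnchorSupply` (text
  verbatim) follows from the Hodge conjecture (its card's "HC-safe … needs only the constant
  family", now formal; a CONDITIONAL record);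
* `qbarFibreAnchor_block_of_definable` / `cycleFibreAnchor_block_of_mem_algebraicClasses` — the
  one-fibre anchors `QbarFibreAnchor` / `CycleFibreAnchor` of the line, pointwise, for arithmetic
  `X` resp. cycle classes (algebraic classes transport along the slice isomorphism);
* `boundarySupply_of_anchorSupply` — the line's split glue at Theorems level:
  `AnchorSupply → HCOverNumberFields → CycleClassesAbsolute → BoundarySupply`;
  `hodgeConjecture_of_anchorSupply` — the route re-glued on `AnchorSupply` (+ the other items and
  `CycleClassesAbsolute`) closes the summit.

## References

* [Deligne1982HodgeCycles] P. Deligne, Hodge cycles on abelian varieties, LNM 900, Thm 2.12.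
* [KerrPearlstein2016] M. Kerr, G. Pearlstein (eds.), Recent Advances in Hodge Theory, CUP 2016
  (M. Saito, C. Schnell, Fields of definition of Hodge loci, Thm 1, Cor. 1).
* [Hartshorne1977] R. Hartshorne, Algebraic Geometry, II.3.
* [Voisin2007HodgeLoci] C. Voisin, Hodge loci and absolute Hodge classes, Compositio 143 (2007),
  Prop. 1.2.
-/

-- every declaration of this problem lives in `Summit.HodgeConjecture.HodgeConjecture.…` (summit = sub-problem)
set_option linter.dupNamespace false

noncomputable section

namespace Summit.HodgeConjecture.HodgeConjecture.Theorems

open CategoryTheory CategoryTheory.Limits AlgebraicGeometry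
open Literature.AlgebraicTopology.SingularHomology
open Literature.AlgebraicGeometry.Motives Literature.AlgebraicGeometry.HodgeTheory
open Summit.HodgeConjecture.HodgeConjecture.Theses

section Anchors

variable {n : ℕ} {X : SchemeOver ℂ}

/-! ### The anchor statements of line `qbar-fibre` -/

/-- **The anchor block for an ARITHMETIC variety.** If `X` (smooth projective of dimension `n`)
is definable over a number field, then for every rational `(p,p)`-class `c` on `X` the `∃`-block of
the registered stub `AnchorSupply` of line `qbar-fibre` holds (constant family; the one piece
`Y = X` is arithmetic). [cite: Deligne1982HodgeCycles, Thm 2.12] [cite: Hartshorne1977, II.3] -/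
theorem anchorSupply_block_of_definable (hX : IsSmoothProjective n X)
    (hdef : ∃ (K : Type) (_ : Field K) (_ : NumberField K) (σ : K →+* ℂ) (X₀ : SchemeOver K),
      Nonempty (X ≅ (baseChangeHom σ).obj X₀))
    (p : ℕ) (c : complexBetti X (2 * p)) (hc : IsRationalClass c)
    (hpp : IsOfHodgeType n X (2 * p) p p c) :
    ∃ (N : ℕ) (𝒳 C : SchemeOver ℂ) (f : 𝒳 ⟶ C) (o t : AlgPoints C ℂ) (ι : Type) (_ : Finite ι)
      (m : ι → ℕ) (Y : ι → SchemeOver ℂ) (g : ∀ i, Y i ⟶ fiberOver f o)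
      (ξ : complexBetti 𝒳 (2 * p)) (n' : ℕ) (e : X ⟶ fiberOver f t),
      IsSmoothProjective N 𝒳 ∧ IsSmoothProjective 1 C ∧ Function.Surjective f.left.base ∧
      (∀ i, IsSmoothProjective (m i) (Y i)) ∧
      (∀ x : ↥(fiberOver f o).left, ∃ (i : ι) (y : ↥(Y i).left), (g i).left.base y = x) ∧
      IsRationalClass ξ ∧ IsOfHodgeType N 𝒳 (2 * p) p p ξ ∧
      (∀ i, (∃ (K : Type) (_ : Field K) (_ : NumberField K) (σ : K →+* ℂ) (Y₀ : SchemeOver K),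
          Nonempty (Y i ≅ (baseChangeHom σ).obj Y₀)) ∨
        complexBetti.map (g i ≫ fiberι f o) (2 * p) ξ ∈ algebraicClasses (Y i) p) ∧
      IsSmoothProjective n' (fiberOver f t) ∧
      complexBetti.map e (2 * p) (complexBetti.map (fiberι f t) (2 * p) ξ) = c :=
  constFamily_block hX p c hc hpp
    (fun _ Y d => (∃ (K : Type) (_ : Field K) (_ : NumberField K) (σ : K →+* ℂ) (Y₀ : SchemeOver K),
      Nonempty (Y ≅ (baseChangeHom σ).obj Y₀)) ∨ d ∈ algebraicClasses Y p)
    (Or.inl hdef)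

/-- **The anchor block for a CYCLE class.** If the rational `(p,p)`-class `c` lies in
`algebraicClasses X p`, then the `∃`-block of the registered stub `AnchorSupply` of line
`qbar-fibre` holds for `c` (constant family; `ξ|_Y = c` is a cycle class on the one piece `Y = X`).
[cite: Deligne1982HodgeCycles, Thm 2.12] [cite: Hartshorne1977, II.3] -/
theorem anchorSupply_block_of_mem_algebraicClasses (hX : IsSmoothProjective n X)
    (p : ℕ) (c : complexBetti X (2 * p)) (hc : IsRationalClass c)
    (hpp : IsOfHodgeType n X (2 * p) p p c) (halg : c ∈ algebraicClasses X p) :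
    ∃ (N : ℕ) (𝒳 C : SchemeOver ℂ) (f : 𝒳 ⟶ C) (o t : AlgPoints C ℂ) (ι : Type) (_ : Finite ι)
      (m : ι → ℕ) (Y : ι → SchemeOver ℂ) (g : ∀ i, Y i ⟶ fiberOver f o)
      (ξ : complexBetti 𝒳 (2 * p)) (n' : ℕ) (e : X ⟶ fiberOver f t),
      IsSmoothProjective N 𝒳 ∧ IsSmoothProjective 1 C ∧ Function.Surjective f.left.base ∧
      (∀ i, IsSmoothProjective (m i) (Y i)) ∧
      (∀ x : ↥(fiberOver f o).left, ∃ (i : ι) (y : ↥(Y i).left), (g i).left.base y = x) ∧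
      IsRationalClass ξ ∧ IsOfHodgeType N 𝒳 (2 * p) p p ξ ∧
      (∀ i, (∃ (K : Type) (_ : Field K) (_ : NumberField K) (σ : K →+* ℂ) (Y₀ : SchemeOver K),
          Nonempty (Y i ≅ (baseChangeHom σ).obj Y₀)) ∨
        complexBetti.map (g i ≫ fiberι f o) (2 * p) ξ ∈ algebraicClasses (Y i) p) ∧
      IsSmoothProjective n' (fiberOver f t) ∧
      complexBetti.map e (2 * p) (complexBetti.map (fiberι f t) (2 * p) ξ) = c :=
  constFamily_block hX p c hc hpp
    (fun _ Y d => (∃ (K : Type) (_ : Field K) (_ : NumberField K) (σ : K →+* ℂ) (Y₀ : SchemeOver K),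
      Nonempty (Y ≅ (baseChangeHom σ).obj Y₀)) ∨ d ∈ algebraicClasses Y p)
    (Or.inr halg)

/-- **`AnchorSupply` follows from the Hodge conjecture** — the registered hardest stub of line
`qbar-fibre` (text verbatim from `Cruxes/BoundarySupply/Lines/qbar_fibre.lean §1`) is HC-safe, as
its card records ("HC ⇒ every `ξ|_{Y_i}` is a cycle class — needs only the constant family"): by
the Hodge conjecture `c` is a cycle class, and `anchorSupply_block_of_mem_algebraicClasses` applies.
A CONDITIONAL record (the hypothesis is the summit). [cite: Deligne1982HodgeCycles, Thm 2.12]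
[cite: KerrPearlstein2016, Saito–Schnell Thm 1 and Cor. 1] -/
theorem anchorSupply_of_hodgeConjecture (h : _root_.HodgeConjecture) :
    ∀ ⦃n : ℕ⦄ ⦃X : Literature.AlgebraicGeometry.Motives.SchemeOver ℂ⦄,
    Literature.AlgebraicGeometry.Motives.IsSmoothProjective n X →
    ∀ (p : ℕ) (c : Literature.AlgebraicGeometry.HodgeTheory.complexBetti X (2 * p)),
      Literature.AlgebraicGeometry.HodgeTheory.IsRationalClass c →
      Literature.AlgebraicGeometry.HodgeTheory.IsOfHodgeType n X (2 * p) p p c →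
      ∃ (N : ℕ) (𝒳 C : Literature.AlgebraicGeometry.Motives.SchemeOver ℂ) (f : 𝒳 ⟶ C)
        (o t : Literature.AlgebraicGeometry.Motives.AlgPoints C ℂ) (ι : Type) (_ : Finite ι) (m : ι → ℕ)
        (Y : ι → Literature.AlgebraicGeometry.Motives.SchemeOver ℂ)
        (g : ∀ i, Y i ⟶ Literature.AlgebraicGeometry.Motives.fiberOver f o)
        (ξ : Literature.AlgebraicGeometry.HodgeTheory.complexBetti 𝒳 (2 * p)) (n' : ℕ)
        (e : X ⟶ Literature.AlgebraicGeometry.Motives.fiberOver f t),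
        Literature.AlgebraicGeometry.Motives.IsSmoothProjective N 𝒳 ∧
        Literature.AlgebraicGeometry.Motives.IsSmoothProjective 1 C ∧
        Function.Surjective f.left.base ∧
        (∀ i, Literature.AlgebraicGeometry.Motives.IsSmoothProjective (m i) (Y i)) ∧
        (∀ x : ↥(Literature.AlgebraicGeometry.Motives.fiberOver f o).left,
          ∃ (i : ι) (y : ↥(Y i).left), (g i).left.base y = x) ∧
        Literature.AlgebraicGeometry.HodgeTheory.IsRationalClass ξ ∧
        Literature.AlgebraicGeometry.HodgeTheory.IsOfHodgeType N 𝒳 (2 * p) p p ξ ∧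
        (∀ i, (∃ (K : Type) (_ : Field K) (_ : NumberField K) (σ : K →+* ℂ)
            (Y₀ : Literature.AlgebraicGeometry.Motives.SchemeOver K),
            Nonempty (Y i ≅ (Literature.AlgebraicGeometry.Motives.baseChangeHom σ).obj Y₀)) ∨
          Literature.AlgebraicGeometry.HodgeTheory.complexBetti.map
              (CategoryTheory.CategoryStruct.comp (g i) (Literature.AlgebraicGeometry.Motives.fiberι f o)) (2 * p) ξ ∈
            Literature.AlgebraicGeometry.HodgeTheory.algebraicClasses (Y i) p) ∧
        Literature.AlgebraicGeometry.Motives.IsSmoothProjective n'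
          (Literature.AlgebraicGeometry.Motives.fiberOver f t) ∧
        Literature.AlgebraicGeometry.HodgeTheory.complexBetti.map e (2 * p)
          (Literature.AlgebraicGeometry.HodgeTheory.complexBetti.map
            (Literature.AlgebraicGeometry.Motives.fiberι f t) (2 * p) ξ) = c :=
  fun _n _X hX p c hc hpp =>
    anchorSupply_block_of_mem_algebraicClasses hX p c hc hpp ((h hX).2 p c hc hpp)

/-- **The smooth arithmetic anchor for an ARITHMETIC variety** (the `∃`-block of the auxiliary
statement `QbarFibreAnchor` of line `qbar-fibre`): if `X` is definable over a number field, every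
rational `(p,p)`-class on `X` is `e^*(ξ|_{X_t})` for the constant family, whose smooth fibre
`X_o ≅ X` is again definable over a number field. [cite: KerrPearlstein2016, Saito–Schnell Thm 1]
[cite: Hartshorne1977, II.3] -/
theorem qbarFibreAnchor_block_of_definable (hX : IsSmoothProjective n X)
    (hdef : ∃ (K : Type) (_ : Field K) (_ : NumberField K) (σ : K →+* ℂ) (X₀ : SchemeOver K),
      Nonempty (X ≅ (baseChangeHom σ).obj X₀))
    (p : ℕ) (c : complexBetti X (2 * p)) (hc : IsRationalClass c)
    (hpp : IsOfHodgeType n X (2 * p) p p c) :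
    ∃ (N : ℕ) (𝒳 C : SchemeOver ℂ) (f : 𝒳 ⟶ C) (o t : AlgPoints C ℂ) (n₀ : ℕ)
      (ξ : complexBetti 𝒳 (2 * p)) (n' : ℕ) (e : X ⟶ fiberOver f t),
      IsSmoothProjective N 𝒳 ∧ IsSmoothProjective 1 C ∧ Function.Surjective f.left.base ∧
      IsSmoothProjective n₀ (fiberOver f o) ∧
      (∃ (K : Type) (_ : Field K) (_ : NumberField K) (σ : K →+* ℂ) (X₀ : SchemeOver K),
        Nonempty (fiberOver f o ≅ (baseChangeHom σ).obj X₀)) ∧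
      IsRationalClass ξ ∧ IsOfHodgeType N 𝒳 (2 * p) p p ξ ∧
      IsSmoothProjective n' (fiberOver f t) ∧
      complexBetti.map e (2 * p) (complexBetti.map (fiberι f t) (2 * p) ξ) = c := by
  refine constFamily_anchor hX p c hc hpp
    (fun Y _ => ∃ (K : Type) (_ : Field K) (_ : NumberField K) (σ : K →+* ℂ) (X₀ : SchemeOver K),
      Nonempty (Y ≅ (baseChangeHom σ).obj X₀)) fun X' e' => ?_
  obtain ⟨K, hK, hK', σ, X₀, ⟨i⟩⟩ := hdef
  exact ⟨K, hK, hK', σ, X₀, ⟨e' ≪≫ i⟩⟩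

/-- **The smooth cycle-class anchor for a CYCLE class** (the `∃`-block of the auxiliary statement
`CycleFibreAnchor` of line `qbar-fibre`): a rational `(p,p)`-class `c ∈ algebraicClasses X p` is
`e^*(ξ|_{X_t})` for the constant family, with `ξ|_{X_o}` a cycle class on the smooth fibre
`X_o ≅ X` (algebraic classes transport along isomorphisms, `mem_algebraicClasses_map_iff_of_iso`).
[cite: Deligne1982HodgeCycles, Thm 2.12] [cite: GrothendieckTopology1969, §1] -/
theorem cycleFibreAnchor_block_of_mem_algebraicClasses (hX : IsSmoothProjective n X)
    (p : ℕ) (c : complexBetti X (2 * p)) (hc : IsRationalClass c)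
    (hpp : IsOfHodgeType n X (2 * p) p p c) (halg : c ∈ algebraicClasses X p) :
    ∃ (N : ℕ) (𝒳 C : SchemeOver ℂ) (f : 𝒳 ⟶ C) (o t : AlgPoints C ℂ) (n₀ : ℕ)
      (ξ : complexBetti 𝒳 (2 * p)) (n' : ℕ) (e : X ⟶ fiberOver f t),
      IsSmoothProjective N 𝒳 ∧ IsSmoothProjective 1 C ∧ Function.Surjective f.left.base ∧
      IsSmoothProjective n₀ (fiberOver f o) ∧
      complexBetti.map (fiberι f o) (2 * p) ξ ∈ algebraicClasses (fiberOver f o) p ∧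
      IsRationalClass ξ ∧ IsOfHodgeType N 𝒳 (2 * p) p p ξ ∧
      IsSmoothProjective n' (fiberOver f t) ∧
      complexBetti.map e (2 * p) (complexBetti.map (fiberι f t) (2 * p) ξ) = c :=
  constFamily_anchor hX p c hc hpp (fun Y d => d ∈ algebraicClasses Y p)
    fun _X' e' => (mem_algebraicClasses_map_iff_of_iso e').2 halg


/-! ### The split glue of line `qbar-fibre` at Theorems level -/

/-- **The split glue of line `qbar-fibre`, kernel-checked at Theorems level** (the crux workfile
`Cruxes/BoundarySupply/Lines/qbar_fibre.lean` is not importable): `AnchorSupply` (registered stub 1,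
text verbatim), the route's own crux #4 `HCOverNumberFields` (stmt-HodgeConjecture-1070) and
"cycle classes are absolute Hodge" (registered stub 3 `CycleClassesAbsolute`, text verbatim) imply
`BoundarySupply`: keep the family; `ξ|_{Y_i}` is rational (`IsRationalClass.pullback`) and of type
`(p,p)` on the smooth projective piece (`IsOfHodgeType.map_of_isSmoothProjective`); on an arithmetic
piece it is algebraic by HC over number fields, and a cycle class is absolute by stub 3. So on route
BoundaryReadout the crux may be replaced by `AnchorSupply` + `CycleClassesAbsolute` (the
strategist's route-shape note), and `AnchorSupply` is HC-safe (`anchorSupply_of_hodgeConjecture`).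
A CONDITIONAL record (all three hypotheses are open in the tree).
[cite: Deligne1982HodgeCycles, Thm 2.12] [cite: Voisin2007HodgeLoci, Prop. 1.2] -/
theorem boundarySupply_of_anchorSupply
    (hS : ∀ ⦃n : ℕ⦄ ⦃X : SchemeOver ℂ⦄, IsSmoothProjective n X →
      ∀ (p : ℕ) (c : complexBetti X (2 * p)), IsRationalClass c → IsOfHodgeType n X (2 * p) p p c →
      ∃ (N : ℕ) (𝒳 C : SchemeOver ℂ) (f : 𝒳 ⟶ C) (o t : AlgPoints C ℂ) (ι : Type) (_ : Finite ι)
        (m : ι → ℕ) (Y : ι → SchemeOver ℂ) (g : ∀ i, Y i ⟶ fiberOver f o)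
        (ξ : complexBetti 𝒳 (2 * p)) (n' : ℕ) (e : X ⟶ fiberOver f t),
        IsSmoothProjective N 𝒳 ∧ IsSmoothProjective 1 C ∧ Function.Surjective f.left.base ∧
        (∀ i, IsSmoothProjective (m i) (Y i)) ∧
        (∀ x : ↥(fiberOver f o).left, ∃ (i : ι) (y : ↥(Y i).left), (g i).left.base y = x) ∧
        IsRationalClass ξ ∧ IsOfHodgeType N 𝒳 (2 * p) p p ξ ∧
        (∀ i, (∃ (K : Type) (_ : Field K) (_ : NumberField K) (σ : K →+* ℂ) (Y₀ : SchemeOver K),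
            Nonempty (Y i ≅ (baseChangeHom σ).obj Y₀)) ∨
          complexBetti.map (g i ≫ fiberι f o) (2 * p) ξ ∈ algebraicClasses (Y i) p) ∧
        IsSmoothProjective n' (fiberOver f t) ∧
        complexBetti.map e (2 * p) (complexBetti.map (fiberι f t) (2 * p) ξ) = c)
    (hQ : BoundaryReadout.HCOverNumberFields)
    (hZ : ∀ ⦃n : ℕ⦄ ⦃X : SchemeOver ℂ⦄, IsSmoothProjective n X →
      ∀ (p : ℕ) (c : complexBetti X (2 * p)), IsRationalClass c → IsOfHodgeType n X (2 * p) p p c →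
        c ∈ algebraicClasses X p → IsAbsoluteHodgeClass n X p c) :
    BoundaryReadout.BoundarySupply := by
  intro n X hX p c hc hpp
  obtain ⟨N, 𝒳, C, f, o, t, ι, hι, m, Y, g, ξ, n', e, h𝒳, hC, hf, hY, hcov, hξr, hξh, hanch, ht, hc'⟩ :=
    hS hX p c hc hpp
  refine ⟨N, 𝒳, C, f, o, t, ι, hι, m, Y, g, ξ, n', e, h𝒳, hC, hf, hY, hcov, hξr, hξh, fun i => ?_, ht, hc'⟩
  -- `ξ|_{Y_i}` is a rational `(p,p)`-class on the smooth projective piece `Y_i`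
  have hr : IsRationalClass (complexBetti.map (g i ≫ fiberι f o) (2 * p) ξ) :=
    hξr.pullback (AlgPoints.mapContinuous (L := ℂ) (g i ≫ fiberι f o))
  have hh : IsOfHodgeType (m i) (Y i) (2 * p) p p (complexBetti.map (g i ≫ fiberι f o) (2 * p) ξ) :=
    hξh.map_of_isSmoothProjective (hY i) h𝒳 _
  rcases hanch i with hdef | halg
  · -- arithmetic piece: algebraic by HC over number fields, hence absolute
    exact hZ (hY i) p _ hr hh ((hQ (hY i) hdef).2 p _ hr hh)
  · -- cycle class on the piece: absolute
    exact hZ (hY i) p _ hr hh halg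

/-- **The route re-glued on the anchor stub.** Route BoundaryReadout closes from `AnchorSupply` in
place of `BoundarySupply`, granted "cycle classes are absolute Hodge": `AnchorSupply`,
`BoundaryAbsoluteness`, `HCOverNumberFields`, `AbsoluteReduction`, `PullbackAlgebraic` and
`CycleClassesAbsolute` imply the Hodge conjecture (the route's deciding theorem `closes` fed with
`boundarySupply_of_anchorSupply`). Kernel-checked form of the strategist's route-shape note ("with this
line, `closes` ⟸ {AnchorSupply, BoundaryAbsoluteness, HCOverNumberFields, AbsoluteReduction,
PullbackAlgebraic, CycleClassesAbsolute}"); every hypothesis is an open item or registered stub.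
[cite: Voisin2007HodgeLoci, Prop. 1.2] [cite: Deligne1982HodgeCycles, Thm 2.12] -/
theorem hodgeConjecture_of_anchorSupply
    (hS : ∀ ⦃n : ℕ⦄ ⦃X : SchemeOver ℂ⦄, IsSmoothProjective n X →
      ∀ (p : ℕ) (c : complexBetti X (2 * p)), IsRationalClass c → IsOfHodgeType n X (2 * p) p p c →
      ∃ (N : ℕ) (𝒳 C : SchemeOver ℂ) (f : 𝒳 ⟶ C) (o t : AlgPoints C ℂ) (ι : Type) (_ : Finite ι)
        (m : ι → ℕ) (Y : ι → SchemeOver ℂ) (g : ∀ i, Y i ⟶ fiberOver f o)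
        (ξ : complexBetti 𝒳 (2 * p)) (n' : ℕ) (e : X ⟶ fiberOver f t),
        IsSmoothProjective N 𝒳 ∧ IsSmoothProjective 1 C ∧ Function.Surjective f.left.base ∧
        (∀ i, IsSmoothProjective (m i) (Y i)) ∧
        (∀ x : ↥(fiberOver f o).left, ∃ (i : ι) (y : ↥(Y i).left), (g i).left.base y = x) ∧
        IsRationalClass ξ ∧ IsOfHodgeType N 𝒳 (2 * p) p p ξ ∧
        (∀ i, (∃ (K : Type) (_ : Field K) (_ : NumberField K) (σ : K →+* ℂ) (Y₀ : SchemeOver K),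
            Nonempty (Y i ≅ (baseChangeHom σ).obj Y₀)) ∨
          complexBetti.map (g i ≫ fiberι f o) (2 * p) ξ ∈ algebraicClasses (Y i) p) ∧
        IsSmoothProjective n' (fiberOver f t) ∧
        complexBetti.map e (2 * p) (complexBetti.map (fiberι f t) (2 * p) ξ) = c)
    (hB : BoundaryReadout.BoundaryAbsoluteness) (hQ : BoundaryReadout.HCOverNumberFields)
    (hR : BoundaryReadout.AbsoluteReduction) (hP : BoundaryReadout.PullbackAlgebraic)
    (hZ : ∀ ⦃n : ℕ⦄ ⦃X : SchemeOver ℂ⦄, IsSmoothProjective n X →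
      ∀ (p : ℕ) (c : complexBetti X (2 * p)), IsRationalClass c → IsOfHodgeType n X (2 * p) p p c →
        c ∈ algebraicClasses X p → IsAbsoluteHodgeClass n X p c) :
    _root_.HodgeConjecture :=
  BoundaryReadout.closes (boundarySupply_of_anchorSupply hS hQ hZ) hB hQ hR hP

end Anchors

end Summit.HodgeConjecture.HodgeConjecture.Theorems

end
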